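import Summits.AtomisticToContinuum.Crystallization.Theses.PRVarianceCertificate
import Summits.AtomisticToContinuum.Crystallization.Theorems.PRVarianceCertificateCoerciveVarianceCertificateMatching
import HarnessLib

/-!
# Line `birth` for piece `CoarseToFine` of crux `CoerciveVarianceCertificate` (route `PRVarianceCertificate`) — birth skeleton (BC3)

Piece (verbatim the registered stub `stub_coarseToFine` of `Cruxes/CoerciveVarianceCertificate/Lines/birth.lean`;
route item `PRVarianceCertificate.CoarseToFine` once the split `CoerciveVarianceCertificate ⇐ PricingLarge ∧ CoarseToFine`
is filed): COARSE-TO-FINE RIGIDITY WITH SCALE PINNING — for every optimal hcp pair `(a, h)` and all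
`R, ε > 0` there is `L > 0` such that in every Lennard-Jones ground state `x`, if every particle within
`L` of `x_i` has its `2a`-window `(a/100)`-congruent (linear isometry, two-way) to a window of `hcp_{a,h}`,
then the `R`-window at `x_i` is `ε`-congruent to a window of `hcp_{a,h}`.

## The line: GEOMETRY × PHYSICS — glue charts at vanishing tolerance; let the ground state supply the vanishing tolerance

The piece mixes two mechanisms that nothing forces to be proved together:

* `stub_chartGluing` (size L; pure metric geometry, NO energy, every `δ`-separated configuration) —
  POINTWISE CHART GLUING AT VANISHING TOLERANCE: for all `δ, R, ε > 0` there are `θ > 0` and `L > 0`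
  such that in every `δ`-separated configuration a particle ALL of whose `L`-neighbours have
  `(2a, θ)`-hcp windows has an `(R, ε)`-hcp window.  Mechanism: overlapping two-shell windows at
  tolerance `θ` share ≥ 13 non-coplanar matched points, so neighbouring charts differ by a symmetry of
  hcp up to `O(θ)` (hcp is vertex-transitive and centrosymmetric; improper `A` allowed); extend the
  chart of `i` shell by shell out to radius `R`, losing `O(θ)` per step; choose `θ(R, ε)` small.  This
  is the pointwise form of the shared crux `HcpDefectCounting.HcpChartGluing` (counting form, tolerance
  `θ(R, ε)` existential as here); the refuted counting statement `OneGrainWindow.OneGrainGluing`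
  (negatives 3506: multiplicity pile-up, `M·#Bad < N` inflated by repeated particles) does not bite a
  POINTWISE implication under `δ`-separation (repeated particles create no good site and `N` does not
  occur).  `θ` depends on `(R, ε)`: at a FIXED tolerance the statement is false (uniformly strained or
  slowly rotating windows), which is exactly why the physics below is needed.
* `stub_thetaRegularity` (size XL; the physics; hardest) — INTERIOR REGULARITY WITH SCALE PINNING AT
  TWO SHELLS: for every `θ > 0` there is `L > 0` such that in every Lennard-Jones GROUND STATE a particle
  all of whose `L`-neighbours are coarse-good (`(2a, a/100)`-hcp windows) has itself a `(2a, θ)`-hcp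
  window.  Content: far (`≥ L`) from every two-shell defect and from the surface, a ground state is
  θ-perfect relaxed hcp at the two-shell scale — (G) the `1 %` windows on `B(x_i, L)` glue to one
  defect-free strained hcp chart (strain `≤ 1/200`), (LS) strict local stability of the OPTIMAL
  `hcp_{a,h}` (energy excess `≥ κ·strain²` modulo null Lagrangians / boundary terms), (CMP) the crack
  competitor bounds the excess energy of a ground state on a defect-free ball `B_L` by `O(L²)`, so the
  mean squared strain is `O(1/L)`, (IR) interior (Campanato-type) regularity of the force-balance system
  at small strain bounds strain and rotation gradients at the centre by their averages — hence the
  two-shell window at `x_i` is within `O(L^{-1/2}) ≤ θ/… ` of an UNSTRAINED hcp window.  Scale pinning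
  is where optimality of `(a, h)` enters (for a non-optimal template the stub is false); the crux
  `ExcessDecayLiouville.HcpLiouville` (+ `PhononStability`) is the blow-down form of (LS)+(IR).
  Trivial for `θ ≥ a/100` (`L` small, `j = i`).  False without the ground-state hypothesis.
* `CoarseToFine_of_stubs` — the kernel-checked composition (no `sorry` outside `stub_*`): `δ` from
  `LennardJonesMinimalDistance_holds`; given `(R, ε)` take `(θ, L₁)` from gluing, `L₂ := L(θ)` from
  regularity, `L := L₁ + L₂`; if every particle within `L` of `x_i` is coarse-good then every particle
  `x_j` within `L₁` of `x_i` has all its `L₂`-neighbours within `L` of `x_i` (triangle inequality), hence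
  coarse-good, hence `x_j` is `(2a, θ)`-good; so `x_i` is `(R, ε)`-good.

Neither stub is the piece re-packaged: gluing has no energy and needs tolerance `θ → 0` as input;
regularity never leaves the two-shell scale (`2a`) in its conclusion.  Both are stated over tree
declarations only (`hcpPeriodicConfiguration`, `energyPerParticle`, `IsGroundState`, `lennardJones`).
Disproof.lean: none exists for the parent crux (`ledger crux ls stmt-AtomisticToContinuum-11860`,
2026-08-17).  Negatives index (22 entries, 4 in this sub: 3506, 4146, 15929, 17253) checked: see the
gluing bullet for 3506; 4146/15929 are first-shell censuses (none asserted); 17253 is linear pricing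
(no pricing here).
-/

noncomputable section

namespace Summit.AtomisticToContinuum.Crystallization.Cruxes.CoarseToFine.Birth

open scoped BigOperators

/-! ## Registered stubs (sorries live ONLY here; signatures fully inlined, one line each) -/

/-- **STUB G — pointwise chart gluing at vanishing tolerance** (size L; pure geometry).  For the
optimal hcp pair `(a, h)` and all `δ, R, ε > 0` there are `θ > 0`, `L > 0` such that in every
`δ`-separated configuration `x` of `ℝ³`: if every particle within `L` of `x_i` has its `2a`-window
`θ`-congruent (linear isometry, two-way) to a window of `hcp_{a,h}`, then the `R`-window at `x_i` is
`ε`-congruent to a window of `hcp_{a,h}`.  Pointwise form of `HcpDefectCounting.HcpChartGluing`;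
immune to the pile-up witness of negatives 3506 (pointwise, `δ`-separated). -/
theorem stub_chartGluing : ∀ (a h : ℝ) (ha : 0 < a) (hh : 0 < h), (∀ (a' h' : ℝ) (ha' : a' ≠ 0) (hh' : h' ≠ 0), (Literature.MathematicalPhysics.StatisticalMechanics.hcpPeriodicConfiguration ha.ne' hh.ne').energyPerParticle Literature.MathematicalPhysics.StatisticalMechanics.lennardJones ≤ (Literature.MathematicalPhysics.StatisticalMechanics.hcpPeriodicConfiguration ha' hh').energyPerParticle Literature.MathematicalPhysics.StatisticalMechanics.lennardJones) → ∀ δ R ε : ℝ, 0 < δ → 0 < R → 0 < ε → ∃ θ : ℝ, 0 < θ ∧ ∃ L : ℝ, 0 < L ∧ ∀ (N : ℕ) (x : Fin N → EuclideanSpace ℝ (Fin 3)), (∀ j k : Fin N, j ≠ k → δ ≤ dist (x j) (x k)) → ∀ i : Fin N, (∀ j : Fin N, dist (x j) (x i) ≤ L → (∃ A : EuclideanSpace ℝ (Fin 3) →ₗᵢ[ℝ] EuclideanSpace ℝ (Fin 3), (∀ p ∈ (Literature.MathematicalPhysics.StatisticalMechanics.hcpPeriodicConfiguration ha.ne' hh.ne').points,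 ‖p‖ ≤ 2 * a → ∃ k : Fin N, dist (x k) (x j + A p) ≤ θ) ∧ (∀ k : Fin N, dist (x k) (x j) ≤ 2 * a → ∃ p ∈ (Literature.MathematicalPhysics.StatisticalMechanics.hcpPeriodicConfiguration ha.ne' hh.ne').points, dist (x k) (x j + A p) ≤ θ))) → (∃ A : EuclideanSpace ℝ (Fin 3) →ₗᵢ[ℝ] EuclideanSpace ℝ (Fin 3), (∀ p ∈ (Literature.MathematicalPhysics.StatisticalMechanics.hcpPeriodicConfiguration ha.ne' hh.ne').points, ‖p‖ ≤ R → ∃ k : Fin N, dist (x k) (x i + A p) ≤ ε) ∧ (∀ k : Fin N, dist (x k) (x i) ≤ R → ∃ p ∈ (Literature.MathematicalPhysics.StatisticalMechanics.hcpPeriodicConfiguration ha.ne' hh.ne').points, dist (x k) (x i + A p) ≤ ε)) := by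
  sorry

/-- **STUB P — interior regularity with scale pinning at two shells** (size XL; the physics; hardest).
For the optimal hcp pair `(a, h)` and every `θ > 0` there is `L > 0` such that in every Lennard-Jones
ground state `x`: if every particle within `L` of `x_i` is coarse-good (`2a`-window `(a/100)`-congruent
to a window of `hcp_{a,h}`), then the `2a`-window at `x_i` is `θ`-congruent to a window of `hcp_{a,h}`.
Far from all two-shell defects a ground state is `θ`-perfect RELAXED hcp at the two-shell scale:
chart gluing at `1 %` + strict local stability of the optimal `hcp_{a,h}` + crack-competitor excess
bound `O(L²)` on defect-free balls + interior regularity of force balance at small strain.  Trivial for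
`θ ≥ a/100`; false for a non-optimal template or without the ground-state hypothesis. -/
theorem stub_thetaRegularity : ∀ (a h : ℝ) (ha : 0 < a) (hh : 0 < h), (∀ (a' h' : ℝ) (ha' : a' ≠ 0) (hh' : h' ≠ 0), (Literature.MathematicalPhysics.StatisticalMechanics.hcpPeriodicConfiguration ha.ne' hh.ne').energyPerParticle Literature.MathematicalPhysics.StatisticalMechanics.lennardJones ≤ (Literature.MathematicalPhysics.StatisticalMechanics.hcpPeriodicConfiguration ha' hh').energyPerParticle Literature.MathematicalPhysics.StatisticalMechanics.lennardJones) → ∀ θ : ℝ, 0 < θ → ∃ L : ℝ, 0 < L ∧ ∀ (N : ℕ) (x : Fin N → EuclideanSpace ℝ (Fin 3)), Literature.MathematicalPhysics.StatisticalMechanics.IsGroundState Literature.MathematicalPhysics.StatisticalMechanics.lennardJones x → ∀ i : Fin N, (∀ j : Fin N, dist (x j) (x i) ≤ L → (∃ A : EuclideanSpace ℝ (Fin 3) →ₗᵢ[ℝ] EuclideanSpace ℝ (Fin 3), (∀ p ∈ (Literature.MathematicalPhysics.StatisticalMechanics.hcpPeriodicConfiguration ha.ne' hh.ne').points, ‖p‖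 ≤ 2 * a → ∃ k : Fin N, dist (x k) (x j + A p) ≤ a / 100) ∧ (∀ k : Fin N, dist (x k) (x j) ≤ 2 * a → ∃ p ∈ (Literature.MathematicalPhysics.StatisticalMechanics.hcpPeriodicConfiguration ha.ne' hh.ne').points, dist (x k) (x j + A p) ≤ a / 100))) → (∃ A : EuclideanSpace ℝ (Fin 3) →ₗᵢ[ℝ] EuclideanSpace ℝ (Fin 3), (∀ p ∈ (Literature.MathematicalPhysics.StatisticalMechanics.hcpPeriodicConfiguration ha.ne' hh.ne').points, ‖p‖ ≤ 2 * a → ∃ k : Fin N, dist (x k) (x i + A p) ≤ θ) ∧ (∀ k : Fin N, dist (x k) (x i) ≤ 2 * a → ∃ p ∈ (Literature.MathematicalPhysics.StatisticalMechanics.hcpPeriodicConfiguration ha.ne' hh.ne').points, dist (x k) (x i + A p) ≤ θ)) := by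
  sorry

/-! ## The composition (kernel-checked, no `sorry` outside the stubs) -/

/-- **`birth` for `CoarseToFine` — the piece from the two stub STATEMENTS** (hypothesis form; the
conclusion is the piece's signature VERBATIM = registered `stub_coarseToFine`): `δ` = uniform minimal
distance of LJ ground states (`LennardJonesMinimalDistance_holds`), `(θ, L₁)` from gluing at `(R, ε)`,
`L₂` from regularity at `θ`, `L := L₁ + L₂`, triangle inequality. [folklore] -/
theorem CoarseToFine_of_stubs : (∀ (a h : ℝ) (ha : 0 < a) (hh : 0 < h), (∀ (a' h' : ℝ) (ha' : a' ≠ 0) (hh' : h' ≠ 0), (Literature.MathematicalPhysics.StatisticalMechanics.hcpPeriodicConfiguration ha.ne' hh.ne').energyPerParticle Literature.MathematicalPhysics.StatisticalMechanics.lennardJones ≤ (Literature.MathematicalPhysics.StatisticalMechanics.hcpPeriodicConfiguration ha' hh').energyPerParticle Literature.MathematicalPhysics.StatisticalMechanics.lennardJones) → ∀ δ R ε : ℝ, 0 < δ → 0 < R → 0 < ε → ∃ θ : ℝ, 0 < θ ∧ ∃ L : ℝ, 0 < L ∧ ∀ (N : ℕ) (x : Fin N → EuclideanSpace ℝ (Fin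 3)), (∀ j k : Fin N, j ≠ k → δ ≤ dist (x j) (x k)) → ∀ i : Fin N, (∀ j : Fin N, dist (x j) (x i) ≤ L → (∃ A : EuclideanSpace ℝ (Fin 3) →ₗᵢ[ℝ] EuclideanSpace ℝ (Fin 3), (∀ p ∈ (Literature.MathematicalPhysics.StatisticalMechanics.hcpPeriodicConfiguration ha.ne' hh.ne').points, ‖p‖ ≤ 2 * a → ∃ k : Fin N, dist (x k) (x j + A p) ≤ θ) ∧ (∀ k : Fin N, dist (x k) (x j) ≤ 2 * a → ∃ p ∈ (Literature.MathematicalPhysics.StatisticalMechanics.hcpPeriodicConfiguration ha.ne' hh.ne').points, dist (x k) (x j + A p) ≤ θ))) → (∃ A : EuclideanSpace ℝ (Fin 3) →ₗᵢ[ℝ] EuclideanSpace ℝ (Fin 3), (∀ p ∈ (Literature.MathematicalPhysics.StatisticalMechanics.hcpPeriodicConfiguration ha.ne' hh.ne').points, ‖p‖ ≤ R → ∃ k : Fin N, dist (x k) (x i + A p) ≤ ε) ∧ (∀ k : Fin N, dist (x k) (x i) ≤ R → ∃ p ∈ (Literature.MathematicalPhysics.StatisticalMechanics.hcpPeriodicConfiguration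 ha.ne' hh.ne').points, dist (x k) (x i + A p) ≤ ε))) → (∀ (a h : ℝ) (ha : 0 < a) (hh : 0 < h), (∀ (a' h' : ℝ) (ha' : a' ≠ 0) (hh' : h' ≠ 0), (Literature.MathematicalPhysics.StatisticalMechanics.hcpPeriodicConfiguration ha.ne' hh.ne').energyPerParticle Literature.MathematicalPhysics.StatisticalMechanics.lennardJones ≤ (Literature.MathematicalPhysics.StatisticalMechanics.hcpPeriodicConfiguration ha' hh').energyPerParticle Literature.MathematicalPhysics.StatisticalMechanics.lennardJones) → ∀ θ : ℝ, 0 < θ → ∃ L : ℝ, 0 < L ∧ ∀ (N : ℕ) (x : Fin N → EuclideanSpace ℝ (Fin 3)), Literature.MathematicalPhysics.StatisticalMechanics.IsGroundState Literature.MathematicalPhysics.StatisticalMechanics.lennardJones x → ∀ i : Fin N, (∀ j : Fin N, dist (x j) (x i) ≤ L → (∃ A : EuclideanSpace ℝ (Fin 3) →ₗᵢ[ℝ] EuclideanSpace ℝ (Fin 3), (∀ p ∈ (Literature.MathematicalPhysics.StatisticalMechanics.hcpPeriodicConfiguration ha.ne' hh.ne').points, ‖p‖ ≤ 2 * a → ∃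 k : Fin N, dist (x k) (x j + A p) ≤ a / 100) ∧ (∀ k : Fin N, dist (x k) (x j) ≤ 2 * a → ∃ p ∈ (Literature.MathematicalPhysics.StatisticalMechanics.hcpPeriodicConfiguration ha.ne' hh.ne').points, dist (x k) (x j + A p) ≤ a / 100))) → (∃ A : EuclideanSpace ℝ (Fin 3) →ₗᵢ[ℝ] EuclideanSpace ℝ (Fin 3), (∀ p ∈ (Literature.MathematicalPhysics.StatisticalMechanics.hcpPeriodicConfiguration ha.ne' hh.ne').points, ‖p‖ ≤ 2 * a → ∃ k : Fin N, dist (x k) (x i + A p) ≤ θ) ∧ (∀ k : Fin N, dist (x k) (x i) ≤ 2 * a → ∃ p ∈ (Literature.MathematicalPhysics.StatisticalMechanics.hcpPeriodicConfiguration ha.ne' hh.ne').points, dist (x k) (x i + A p) ≤ θ))) → (∀ (a h : ℝ) (ha : 0 < a) (hh : 0 < h), (∀ (a' h' : ℝ) (ha' : a' ≠ 0) (hh' : h' ≠ 0), (Literature.MathematicalPhysics.StatisticalMechanics.hcpPeriodicConfiguration ha.ne' hh.ne').energyPerParticle Literature.MathematicalPhysics.StatisticalMechanics.lennardJones ≤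 (Literature.MathematicalPhysics.StatisticalMechanics.hcpPeriodicConfiguration ha' hh').energyPerParticle Literature.MathematicalPhysics.StatisticalMechanics.lennardJones) → ∀ R ε : ℝ, 0 < R → 0 < ε → ∃ L : ℝ, 0 < L ∧ ∀ (N : ℕ) (x : Fin N → EuclideanSpace ℝ (Fin 3)), Literature.MathematicalPhysics.StatisticalMechanics.IsGroundState Literature.MathematicalPhysics.StatisticalMechanics.lennardJones x → ∀ i : Fin N, (∀ j : Fin N, dist (x j) (x i) ≤ L → (∃ A : EuclideanSpace ℝ (Fin 3) →ₗᵢ[ℝ] EuclideanSpace ℝ (Fin 3), (∀ p ∈ (Literature.MathematicalPhysics.StatisticalMechanics.hcpPeriodicConfiguration ha.ne' hh.ne').points, ‖p‖ ≤ 2 * a → ∃ k : Fin N, dist (x k) (x j + A p) ≤ a / 100) ∧ (∀ k : Fin N, dist (x k) (x j) ≤ 2 * a → ∃ p ∈ (Literature.MathematicalPhysics.StatisticalMechanics.hcpPeriodicConfiguration ha.ne' hh.ne').points, dist (x k) (x j + A p) ≤ a / 100))) → (∃ A : EuclideanSpace ℝ (Fin 3) →ₗᵢ[ℝ] EuclideanSpace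 ℝ (Fin 3), (∀ p ∈ (Literature.MathematicalPhysics.StatisticalMechanics.hcpPeriodicConfiguration ha.ne' hh.ne').points, ‖p‖ ≤ R → ∃ k : Fin N, dist (x k) (x i + A p) ≤ ε) ∧ (∀ k : Fin N, dist (x k) (x i) ≤ R → ∃ p ∈ (Literature.MathematicalPhysics.StatisticalMechanics.hcpPeriodicConfiguration ha.ne' hh.ne').points, dist (x k) (x i + A p) ≤ ε))) := by
  intro hG hP a h ha hh hopt R ε hR hε
  obtain ⟨δ, hδ, hsep⟩ := Literature.MathematicalPhysics.StatisticalMechanics.LennardJonesMinimalDistance_holds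
  obtain ⟨θ, hθ, L₁, hL₁, hglue⟩ := hG a h ha hh hopt δ R ε hδ hR hε
  obtain ⟨L₂, hL₂, hreg⟩ := hP a h ha hh hopt θ hθ
  refine ⟨L₁ + L₂, by positivity, ?_⟩
  intro N x hx i hcoarse
  refine hglue N x (fun j k hjk => hsep N x hx j k hjk) i ?_
  intro j hj
  refine hreg N x hx j ?_
  intro k hk
  refine hcoarse k ?_
  calc dist (x k) (x i) ≤ dist (x k) (x j) + dist (x j) (x i) := dist_triangle _ _ _
    _ ≤ L₂ + L₁ := add_le_add hk hj
    _ = L₁ + L₂ := add_comm _ _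

/-- The piece's statement from the registered stubs (the only `sorry`s in its cone are
`stub_chartGluing`, `stub_thetaRegularity`).  Once the split is filed this is re-typed BY NAME as
`CoarseToFine_of : …Theses.PRVarianceCertificate.CoarseToFine` (definitional unfolding only). -/
theorem CoarseToFine_of_stubs' : ∀ (a h : ℝ) (ha : 0 < a) (hh : 0 < h), (∀ (a' h' : ℝ) (ha' : a' ≠ 0) (hh' : h' ≠ 0), (Literature.MathematicalPhysics.StatisticalMechanics.hcpPeriodicConfiguration ha.ne' hh.ne').energyPerParticle Literature.MathematicalPhysics.StatisticalMechanics.lennardJones ≤ (Literature.MathematicalPhysics.StatisticalMechanics.hcpPeriodicConfiguration ha' hh').energyPerParticle Literature.MathematicalPhysics.StatisticalMechanics.lennardJones) → ∀ R ε : ℝ, 0 < R → 0 < ε → ∃ L : ℝ, 0 < L ∧ ∀ (N : ℕ) (x : Fin N → EuclideanSpace ℝ (Fin 3)), Literature.MathematicalPhysics.StatisticalMechanics.IsGroundState Literature.MathematicalPhysics.StatisticalMechanics.lennardJones x → ∀ i : Fin N, (∀ j : Fin N, dist (x j) (x i) ≤ L → (∃ A : EuclideanSpace ℝ (Fin 3)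 →ₗᵢ[ℝ] EuclideanSpace ℝ (Fin 3), (∀ p ∈ (Literature.MathematicalPhysics.StatisticalMechanics.hcpPeriodicConfiguration ha.ne' hh.ne').points, ‖p‖ ≤ 2 * a → ∃ k : Fin N, dist (x k) (x j + A p) ≤ a / 100) ∧ (∀ k : Fin N, dist (x k) (x j) ≤ 2 * a → ∃ p ∈ (Literature.MathematicalPhysics.StatisticalMechanics.hcpPeriodicConfiguration ha.ne' hh.ne').points, dist (x k) (x j + A p) ≤ a / 100))) → (∃ A : EuclideanSpace ℝ (Fin 3) →ₗᵢ[ℝ] EuclideanSpace ℝ (Fin 3), (∀ p ∈ (Literature.MathematicalPhysics.StatisticalMechanics.hcpPeriodicConfiguration ha.ne' hh.ne').points, ‖p‖ ≤ R → ∃ k : Fin N, dist (x k) (x i + A p) ≤ ε) ∧ (∀ k : Fin N, dist (x k) (x i) ≤ R → ∃ p ∈ (Literature.MathematicalPhysics.StatisticalMechanics.hcpPeriodicConfiguration ha.ne' hh.ne').points, dist (x k) (x i + A p) ≤ ε)) :=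
  CoarseToFine_of_stubs stub_chartGluing stub_thetaRegularity

end Summit.AtomisticToContinuum.Crystallization.Cruxes.CoarseToFine.Birth

end
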